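import Literature.NumberTheory.LFunctions.MertensErrorTermsMeanValueRHLandau
import Literature.NumberTheory.LFunctions.PsiTailIntegralExplicit
import Literature.NumberTheory.LFunctions.ZetaZeroReciprocalSum
import HarnessLib

/-!
# RH-EQUIVALENT literature, proof layer — «nothing here bears on the truth of RH»
# Zhao 2025, Theorem 1 (`i = 1`), sufficiency half in eventual form PROVED: `RH ⟹ ∫₂^X E₁(x) dx → +∞`

Proof companion of `MertensErrorTermsMeanValueRH.lean` (T. Zhao, Res. Number Theory 11 (2025) 62 =
arXiv:2411.18903 [bib: `Zhao2025MertensMean`]); theorems only, no definition, no named fact. §2 of the source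
("Proof of Theorem 1, sufficiency") shows under RH that `∫₂^X E₁(x) dx > 0` for all `X > 2`: for `X ≥ 10⁸` from (2.1),
`∫₂^X E₁ = −X ∫_X^∞ (θ − x)/x² + 2 log 2 − 2 + 2ℰ₁`, the explicit formula for `∫_X^∞ (ψ(x) − x) x⁻² dx` (its
zero sum is `≤ B₁/√X`, `B₁ = Σ_ρ 1/|ρ|² = 0.0461…`, (2.3)) and `ψ − θ > 0.98√x` (`x ≥ 121`, [RS]); for
`2 ≤ X ≤ 10⁸` from the numerical fact "`E₁(x) > 0` for `2 ≤ x ≤ 10⁸`". This file PROVES the large-`X` part with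
the tree's exact inputs and without numerics, in the form

  `RH ⟹ ∫₂^X E₁(x) dx → +∞` (`Zhao2025.tendsto_integral_E₁_atTop_of_RH`), hence `> 0` for all large `X`
  (`Zhao2025.eventually_integral_E₁_pos_of_RH`),

and, with the necessity half of `MertensErrorTermsMeanValueRHLandau.lean`, the equivalence

  `RH ⟺ ∃ X₀, ∀ X > X₀, ∫₂^X E₁(x) dx > 0` (`Zhao2025.riemannHypothesis_iff_eventually_integral_E₁_pos`),

i.e. Theorem 1 (`i = 1`) with (b) read "for all sufficiently large `X`" (as the source itself phrases (b) in its
Theorems 3–4). The residual finite range `2 < X ≤ X₀` of the printed (b) ("for all `X > 2`") rests on the source's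
numerical input `E₁(x) > 0` (`2 ≤ x ≤ 10⁸`) and is NOT formalized here; the named fact `Zhao2025MertensMean_thm1`
keeps the printed form. Inputs: the tree's Rosser–Schoenfeld Lemma 7 in exact form
(`PsiTailIntegral.integral_Ioi_psi_sub_self_div_sq_le`: `∫_x^∞ (ψ − t)/t² ≤ K(x) − log(2π)/x + 1/(2x(x² − 1))`),
`K(x) = x^{-1/2} Σ_ρ m(ρ)/|ρ|² = x^{-1/2} β` under RH (`hasSum_zeroOrder_div_norm_sq_of_RH`, `β = nicolasBeta =
2 + γ − log 4π < 0.0474`, the source's `B₁`), and `ψ − θ ≥ √x/2` for large `x` (Mathlib's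
`Chebyshev.psi_sub_theta_ge_psi_add_psi_add_psi` with the prime number theorem for `θ` at `√x`) in place of
`0.98√x`; so `X ∫_X^∞ (θ − t)/t² ≤ (β − 1)√X + 1` and `∫₂^X E₁ ≥ 2C − 1 + (1 − β)√X → ∞`.
-/

noncomputable section

open Filter Topology Set MeasureTheory
open scoped Real Chebyshev

namespace Literature.NumberTheory.LFunctions

namespace Zhao2025

open PsiTailIntegral NicolasJExplicit

/-! ### The zero sum `K(x)` under RH -/

/-- Under RH every non-trivial zero has real part `1/2`. [cite: Zhao2025MertensMean, §2 (use of RH in (2.2)–(2.3))] -/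
theorem re_eq_half_of_RH (hRH : RiemannHypothesis) (ρ : Zeros) : (ρ : ℂ).re = 1 / 2 := by
  refine hRH ρ (ZetaZeros.riemannZetaNontrivialZeros.zeta_eq_zero ρ.2) ?_
    (ZetaZeros.riemannZetaNontrivialZeros.ne_one ρ.2)
  rintro ⟨n, hn⟩
  have := ZetaZeros.riemannZetaNontrivialZeros.re_pos ρ.2
  rw [hn] at this
  simp at this
  linarith [(n.cast_nonneg : (0 : ℝ) ≤ n)]

/-- **Under RH, `K(x) = Σ_ρ m(ρ) x^{β−1}/(|ρ||ρ−1|) = x^{-1/2} Σ_ρ m(ρ)/|ρ|² = x^{-1/2}·β`** (`β = B₁ = 0.0461…`,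
the source's (2.3)). [cite: Zhao2025MertensMean, §2 (2.3)] -/
theorem rsK_eq_of_RH (hRH : RiemannHypothesis) {x : ℝ} (hx : 0 < x) :
    rsK x = x ^ (-(1 / 2 : ℝ)) * nicolasBeta := by
  rw [rsK]
  have hterm : ∀ ρ : Zeros, ‖tailZeroTerm ρ x‖ =
      x ^ (-(1 / 2 : ℝ)) * ((riemannZetaZeroOrder (ρ : ℂ) : ℝ) / ‖(ρ : ℂ)‖ ^ 2) := by
    intro ρ
    rw [norm_tailZeroTerm hx ρ, norm_sub_one_eq_norm_of_re_eq_half (re_eq_half_of_RH hRH ρ),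
      re_eq_half_of_RH hRH ρ, show (1 / 2 : ℝ) - 1 = -(1 / 2) by norm_num, sq]
    ring
  simp_rw [hterm]
  exact ((hasSum_zeroOrder_div_norm_sq_of_RH hRH).mul_left _).tsum_eq

/-! ### `ψ − θ ≥ √x/2` for large `x` -/

/-- `ψ(t) − θ(t) ≥ √t/2` for all large `t` (from `ψ − θ ≥ ψ(√t) ≥ θ(√t)` and the prime number theorem
`θ(y) ≥ y − Cy/log y ≥ y/2`); the source uses Rosser–Schoenfeld's `ψ − θ > 0.98√x` (`x ≥ 121`), (2.2).
[cite: Zhao2025MertensMean, §2 (2.2)] -/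
theorem exists_half_sqrt_le_psi_sub_theta :
    ∃ X₂ : ℝ, 2 ≤ X₂ ∧ ∀ t : ℝ, X₂ ≤ t → Real.sqrt t / 2 ≤ ψ t - θ t := by
  obtain ⟨C, hC0, hC⟩ := Mertens.exists_abs_theta_sub_le_div_log_pow 1
  set Y₀ : ℝ := max 2 (Real.exp (2 * C)) with hY₀
  have hY₀2 : 2 ≤ Y₀ := le_max_left _ _
  refine ⟨Y₀ ^ 2, by nlinarith, fun t ht => ?_⟩
  have ht0 : 0 ≤ t := le_trans (by positivity) ht
  set y : ℝ := Real.sqrt t with hy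
  have hy₀ : Y₀ ≤ y := by
    rw [hy, ← Real.sqrt_sq (by linarith : (0 : ℝ) ≤ Y₀)]
    exact Real.sqrt_le_sqrt ht
  have hy2 : 2 ≤ y := hY₀2.trans hy₀
  have hlog : 2 * C ≤ Real.log y := by
    rw [← Real.log_exp (2 * C)]
    exact Real.log_le_log (Real.exp_pos _) ((le_max_right _ _).trans hy₀)
  have hlogpos : 0 < Real.log y := Real.log_pos (by linarith)
  -- `θ(y) ≥ y/2`
  have hθ : y / 2 ≤ θ y := by
    have h1 := hC y hy2
    rw [pow_one] at h1
    have h2 : C * y / Real.log y ≤ y / 2 := by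
      rw [div_le_iff₀ hlogpos]
      nlinarith
    have h3 := neg_abs_le (θ y - y)
    linarith
  -- `ψ(t) − θ(t) ≥ ψ(√t) ≥ θ(√t)`
  have h4 := Chebyshev.psi_sub_theta_ge_psi_add_psi_add_psi ht0
  have hsq : t ^ (2 : ℝ)⁻¹ = y := by
    rw [hy, Real.sqrt_eq_rpow]; norm_num
  rw [hsq] at h4
  have h5 := Chebyshev.theta_le_psi y
  have h6 : 0 ≤ ψ (t ^ (3 : ℝ)⁻¹) := Chebyshev.psi_nonneg _
  have h7 : 0 ≤ ψ (t ^ (7 : ℝ)⁻¹) := Chebyshev.psi_nonneg _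
  linarith

/-- `∫_x^∞ (ψ − θ)/t² ≥ ∫_x^∞ t^{-3/2}/2 = x^{-1/2}` once `ψ − θ ≥ √t/2` on `[x, ∞)` — the source's
`∫_X^∞ (ψ − θ)/x² > 1.96/√X`. [cite: Zhao2025MertensMean, §2 (display after (2.2))] -/
theorem rpow_neg_half_le_integral_psi_sub_theta {X₂ x : ℝ} (hX₂ : 2 ≤ X₂)
    (hψθ : ∀ t : ℝ, X₂ ≤ t → Real.sqrt t / 2 ≤ ψ t - θ t) (hx : X₂ ≤ x) :
    x ^ (-(1 / 2 : ℝ)) ≤ ∫ t in Ioi x, (ψ t - θ t) / t ^ 2 := by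
  have hx0 : 0 < x := by linarith
  have hval : ∫ t in Ioi x, (1 / 2 : ℝ) * t ^ (-(3 / 2 : ℝ)) = x ^ (-(1 / 2 : ℝ)) := by
    rw [integral_const_mul, integral_Ioi_rpow_of_lt (by norm_num) hx0,
      show (-(3 / 2 : ℝ) + 1) = -(1 / 2) by norm_num]
    ring
  rw [← hval]
  refine setIntegral_mono_on ((integrableOn_Ioi_rpow_of_lt (by norm_num : (-(3 / 2 : ℝ)) < -1) hx0).const_mul _)
    (RosserSchoenfeld.integrableOn_psi_sub_theta_div_sq.mono_set (Ioi_subset_Ioi (by linarith)))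
    measurableSet_Ioi fun t ht => ?_
  have htx : x < t := ht
  have ht0 : 0 < t := hx0.trans htx
  have hrp : (1 / 2 : ℝ) * t ^ (-(3 / 2 : ℝ)) = (Real.sqrt t / 2) / t ^ 2 := by
    rw [Real.sqrt_eq_rpow, show (-(3 / 2 : ℝ)) = 1 / 2 - 2 by norm_num, Real.rpow_sub ht0, Real.rpow_two]
    ring
  rw [hrp]
  exact div_le_div_of_nonneg_right (hψθ t (hx.trans htx.le)) (by positivity)

/-! ### The tail `X ∫_X^∞ (θ − t)/t²` under RH -/

/-- **Under RH, `X ∫_X^∞ (θ(t) − t) t⁻² dt ≤ (β − 1)√X + 1`** for large `X` (the source's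
`∫_X^∞ (θ − x)/x² < (B₁ − 1.96)/√X`): split `θ − t = (ψ − t) − (ψ − θ)`, bound the first tail by Rosser–Schoenfeld's
Lemma 7 (`K(X) = β/√X`, `−log(2π)/X ≤ 0`, `1/(2X(X²−1)) ≤ 1/X`) and the second from below by `1/√X`.
[cite: Zhao2025MertensMean, §2 (display after (2.2))] -/
theorem mul_tail_le_of_RH (hRH : RiemannHypothesis) {X₂ x : ℝ} (hX₂ : 2 ≤ X₂)
    (hψθ : ∀ t : ℝ, X₂ ≤ t → Real.sqrt t / 2 ≤ ψ t - θ t) (hx : X₂ ≤ x) :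
    x * ∫ t in Ioi x, (θ t - t) / t ^ 2 ≤ (nicolasBeta - 1) * Real.sqrt x + 1 := by
  have hx1 : 1 < x := by linarith
  have hx0 : 0 < x := by linarith
  have hsplit : ∫ t in Ioi x, (θ t - t) / t ^ 2 =
      (∫ t in Ioi x, (ψ t - t) / t ^ 2) - ∫ t in Ioi x, (ψ t - θ t) / t ^ 2 := by
    rw [← integral_sub (RosserSchoenfeld.integrableOn_psi_sub_self_div_sq.mono_set (Ioi_subset_Ioi hx1.le))
      (RosserSchoenfeld.integrableOn_psi_sub_theta_div_sq.mono_set (Ioi_subset_Ioi hx1.le))]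
    refine setIntegral_congr_fun measurableSet_Ioi fun t _ => ?_
    ring
  have h1 := integral_Ioi_psi_sub_self_div_sq_le hx1
  rw [rsK_eq_of_RH hRH hx0] at h1
  have h2 := rpow_neg_half_le_integral_psi_sub_theta hX₂ hψθ hx
  have hlog : 0 ≤ Real.log (2 * π) / x :=
    div_nonneg (Real.log_nonneg (by linarith [Real.pi_gt_three])) hx0.le
  have hx2 : 2 ≤ x := hX₂.trans hx
  have h3 : 1 / (2 * x * (x ^ 2 - 1)) ≤ 1 / x :=
    one_div_le_one_div_of_le hx0 (by nlinarith)
  have hsqrt : x * x ^ (-(1 / 2 : ℝ)) = Real.sqrt x := by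
    have e : x ^ (1 / 2 : ℝ) = x ^ ((1 : ℝ) + -(1 / 2)) := by norm_num
    rw [Real.sqrt_eq_rpow, e, Real.rpow_add hx0, Real.rpow_one]
  rw [hsplit]
  calc x * ((∫ t in Ioi x, (ψ t - t) / t ^ 2) - ∫ t in Ioi x, (ψ t - θ t) / t ^ 2)
      ≤ x * (x ^ (-(1 / 2 : ℝ)) * nicolasBeta + 1 / x - x ^ (-(1 / 2 : ℝ))) := by
        refine mul_le_mul_of_nonneg_left ?_ hx0.le
        linarith
    _ = (nicolasBeta - 1) * (x * x ^ (-(1 / 2 : ℝ))) + 1 := by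
        field_simp
        ring
    _ = (nicolasBeta - 1) * Real.sqrt x + 1 := by rw [hsqrt]

/-! ### Theorem 1 (`i = 1`), (a) ⟹ (b) for large `X`, and the equivalence -/

/-- **Under RH, `∫₂^X E₁(x) dx → +∞`**: by (2.1) and `mul_tail_le_of_RH`,
`∫₂^X E₁ = 2C − X ∫_X^∞ (θ − t)/t² ≥ 2C − 1 + (1 − β)√X` with `1 − β > 0.95` (`β < 0.0474`) — the source's
"It follows that `∫₂^X E₁(x) dx > 0`". [cite: Zhao2025MertensMean, Thm 1 (i = 1), (a) ⟹ (b); §2] -/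
theorem tendsto_integral_E₁_atTop_of_RH (hRH : RiemannHypothesis) :
    Tendsto (fun X : ℝ => ∫ x in (2 : ℝ)..X, E₁ x) atTop atTop := by
  obtain ⟨X₂, hX₂, hψθ⟩ := exists_half_sqrt_le_psi_sub_theta
  set C : ℝ := ∫ t in Ioi (2 : ℝ), (θ t - t) / t ^ 2 with hC
  have hβ : 0 < 1 - nicolasBeta := by linarith [nicolasBeta_lt']
  have hlow : ∀ᶠ X : ℝ in atTop,
      2 * C - 1 + (1 - nicolasBeta) * Real.sqrt X ≤ ∫ x in (2 : ℝ)..X, E₁ x := by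
    filter_upwards [eventually_ge_atTop X₂] with X hX
    rw [integral_E₁_eq (hX₂.trans hX)]
    have := mul_tail_le_of_RH hRH hX₂ hψθ hX
    linarith
  refine tendsto_atTop_mono' atTop hlow ?_
  have h0 : Tendsto (fun X : ℝ => Real.sqrt X) atTop atTop := by
    have : (fun X : ℝ => Real.sqrt X) = fun X => X ^ (1 / 2 : ℝ) := funext fun X => Real.sqrt_eq_rpow X
    rw [this]
    exact tendsto_rpow_atTop (by norm_num)
  exact tendsto_atTop_add_const_left _ _ (h0.const_mul_atTop hβ)

/-- **Zhao 2025, Theorem 1 (`i = 1`), (a) ⟹ (b) for all sufficiently large `X`**: under RH,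
`∫₂^X E₁(x) dx > 0` for all large `X`. [cite: Zhao2025MertensMean, Thm 1 (i = 1), (a) ⟹ (b); §2] -/
theorem eventually_integral_E₁_pos_of_RH (hRH : RiemannHypothesis) :
    ∀ᶠ X : ℝ in atTop, 0 < ∫ x in (2 : ℝ)..X, E₁ x :=
  (tendsto_integral_E₁_atTop_of_RH hRH).eventually_gt_atTop 0

/-- **Zhao 2025, Theorem 1 (`i = 1`) in the "sufficiently large `X`" reading, PROVED**:
`RH ⟺ ∃ X₀, ∀ X > X₀, ∫₂^X E₁(x) dx > 0` (`⟸` is `Zhao2025.riemannHypothesis_of_integral_E₁_nonneg`, Landau's theorem;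
`⟹` is `eventually_integral_E₁_pos_of_RH`). The printed (b) has `X > 2`; its finite range `2 < X ≤ X₀` is the
source's numerical input and is not formalized. [cite: Zhao2025MertensMean, Thm 1 (i = 1)] -/
theorem riemannHypothesis_iff_eventually_integral_E₁_pos :
    RiemannHypothesis ↔ ∃ X₀ : ℝ, ∀ X : ℝ, X₀ < X → 0 < ∫ x in (2 : ℝ)..X, E₁ x := by
  constructor
  · intro hRH
    obtain ⟨X₀, hX₀⟩ := (eventually_integral_E₁_pos_of_RH hRH).exists_forall_of_atTop
    exact ⟨X₀, fun X hX => hX₀ X hX.le⟩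
  · rintro ⟨X₀, h⟩
    exact riemannHypothesis_of_integral_E₁_nonneg (X₁ := X₀) fun X hX => (h X hX).le

end Zhao2025

end Literature.NumberTheory.LFunctions
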